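import Literature.Geometry.Lorentzian.EventHorizonArea
import Literature.Geometry.Lorentzian.NullCornerChronology
import Literature.Geometry.Lorentzian.GeodesicOneSidedUniqueness
import Literature.Geometry.Lorentzian.LeviCivitaProofs
import HarnessLib

/-!
# Towards the area theorem: no corners on achronal sets, rigidity of the generators of a horizon,
# and the sections of a horizon by slicing hypersurfaces

Bricks of the proof of the named fact `Literature.Geometry.Lorentzian.ChruscielEtAl2001_areaTheorem`
(`EventHorizonArea.lean`; Chruściel–Delay–Galloway–Howard, Ann. Henri Poincaré 2 (2001) 109,
Thm. 1.1 (b) = Thm. 6.1 with Prop. 4.17), all **proved**, in the vocabulary of that file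
(`Spacetime.IsRuledByCompleteNullGeodesics`, `LorentzianMetric.IsAchronal`,
`Manifold.IsSmoothEmbedding`, `area`). They formalise the elementary structure theory of future
horizons in CDGH §2 and the first step of the proof of their Thm. 6.1 (§6, p. 137: "the condition
(6.1) together with achronality of `𝓗` imply that every `q ∈ A` is on exactly one of the
generators"):

* `LorentzianMetric.IsAchronal.exists_pos_smul_velocity_eq` — **an achronal set has no corners**:
  if a future causal curve ending at `p` and a future causal curve starting at `p` have their far
  endpoints in an achronal set `S`, their velocities at `p` are positively proportional (otherwise
  the corner lemma `LorentzianMetric.mem_chronologicalFuture_of_corner`, O'Neill 1983, Prop. 10.46,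
  puts the two endpoints into chronological relation); `…_of_crossing` is the version for two causal
  curves through a common point;
* `Spacetime.isFutureCausalCurveOn_of_nullRay` — a future null geodesic ray is a future causal
  curve on every compact parameter interval;
* `Spacetime.exists_eqOn_ray_of_achronal` — **rigidity of generators** (CDGH §2; Beem–Królak):
  in an achronal set `𝓗`, a future null geodesic ray `γ'` of `𝓗` issuing from (or passing through)
  a point `γ t` of a future null geodesic ray `γ` of `𝓗`, `t` not the initial parameter of `γ`, is
  the continuation of `γ`: `γ' s = γ (t + c (s - t'))` for all `s ≥ t'`, for some `c > 0`
  (no-corner lemma, then one-sided uniqueness of geodesics,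
  `IsGeodesicOn.eqOn_Ici_comp_affine_of_velocity_eq_smul`) — in particular through every point of a
  future horizon which is interior to some generator there passes exactly one generator;
* `isClosed_preimage_horizon`, `measurableSet_preimage_horizon` — the section `σ⁻¹(𝓗)` of a closed
  `𝓗` by a slicing hypersurface `σ : L → M` (a smooth embedding) is closed, hence Borel (CDGH
  Prop. 3.3 in the setting of `ChruscielEtAl2001_areaTheorem`, where it is immediate), and
  `area_preimage_le_of_eq_empty` — the area inequality in the degenerate case of an empty earlier
  section.

No definitions and no named facts are introduced.

## References

* P. T. Chruściel, E. Delay, G. J. Galloway, R. Howard, *Regularity of horizons and the area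
  theorem*, Ann. Henri Poincaré 2 (2001) 109–178 = arXiv:gr-qc/0001003, §2 (future horizons,
  generators), Prop. 3.3, §6 (proof of Thm. 6.1, first step). Key `ChruscielEtAl2001`.
* B. O'Neill, *Semi-Riemannian geometry with applications to relativity*, Academic Press 1983,
  Ch. 10, Prop. 10.46; Ch. 14, p. 413 (achronal sets). Key `ONeillSemiRiemannian1983`.
* J. K. Beem, A. Królak, *Cauchy horizon end points and differentiability*, J. Math. Phys. 39
  (1998) 6001–6010 (generators through interior points are unique).
-/

noncomputable section

open Bundle Set Filter Function Manifold MeasureTheory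
open scoped Manifold ContDiff Topology

namespace Literature.Geometry.Lorentzian

universe u

/-! ### Achronal sets have no corners -/

section Achronal

variable {E : Type*} [NormedAddCommGroup E] [NormedSpace ℝ E] {H : Type*} [TopologicalSpace H]
  {I : ModelWithCorners ℝ E H} {n : ℕ∞ω} {M : Type*} [TopologicalSpace M] [ChartedSpace H M]
  [IsManifold I ∞ M]

namespace LorentzianMetric

variable {g : LorentzianMetric I n M} {τ : TimeOrientation g}

/-- **An achronal set has no corners.** On a finite-dimensional manifold without boundary with a
`Cⁿ` (`n ≥ 1`) time-oriented Lorentzian metric, let `S` be achronal, `γ₁` a future causal curve on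
`[a₁, b₁]` starting in `S` and `γ₂` a future causal curve on `[a₂, b₂]` ending in `S`, with
`γ₁ b₁ = γ₂ a₂`. Then the velocities at the junction are positively proportional,
`γ₂'(a₂) = c γ₁'(b₁)` with `c > 0` — otherwise `γ₂ b₂ ∈ I⁺(γ₁ a₁)`
(`mem_chronologicalFuture_of_corner`, O'Neill 1983, Ch. 10, Prop. 10.46), contradicting
achronality (O'Neill 1983, Ch. 14, p. 413). This is the mechanism behind "generators of an achronal
null hypersurface do not cross" (Chruściel–Delay–Galloway–Howard 2001, §2).
[cite: ONeillSemiRiemannian1983, Ch. 10, Prop. 10.46 and Ch. 14, p. 413] -/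
theorem IsAchronal.exists_pos_smul_velocity_eq [BoundarylessManifold I M] [FiniteDimensional ℝ E]
    (hn : 1 ≤ n) {S : Set M} (hS : g.IsAchronal τ S) {γ₁ γ₂ : ℝ → M} {a₁ b₁ a₂ b₂ : ℝ}
    (hab₁ : a₁ < b₁) (hab₂ : a₂ < b₂)
    (hγ₁ : g.IsFutureCausalCurveOn τ γ₁ (Icc a₁ b₁)) (hγ₂ : g.IsFutureCausalCurveOn τ γ₂ (Icc a₂ b₂))
    (hjoin : γ₁ b₁ = γ₂ a₂) (h₁ : γ₁ a₁ ∈ S) (h₂ : γ₂ b₂ ∈ S) :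
    ∃ c : ℝ, 0 < c ∧ (velocity I γ₂ a₂ : E) = c • (velocity I γ₁ b₁ : E) := by
  by_contra hc
  exact hS (γ₁ a₁) h₁ (γ₂ b₂) h₂ (mem_chronologicalFuture_of_corner hn hab₁ hab₂ hγ₁ hγ₂ hjoin hc)

/-- **Causal curves in an achronal set cross tangentially.** If two future causal curves
`γ₁ : [a₁, b₁] → M`, `γ₂ : [a₂, b₂] → M` with `γ₁ a₁, γ₂ b₂` in an achronal set `S` meet,
`γ₁ t₁ = γ₂ t₂` with `a₁ < t₁ ≤ b₁` and `a₂ ≤ t₂ < b₂`, then their velocities at the meeting point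
are positively proportional. O'Neill 1983, Ch. 10, Prop. 10.46 with Ch. 14, p. 413.
[cite: ONeillSemiRiemannian1983, Ch. 10, Prop. 10.46 and Ch. 14, p. 413] -/
theorem IsAchronal.exists_pos_smul_velocity_eq_of_crossing [BoundarylessManifold I M]
    [FiniteDimensional ℝ E] (hn : 1 ≤ n) {S : Set M} (hS : g.IsAchronal τ S) {γ₁ γ₂ : ℝ → M}
    {a₁ b₁ a₂ b₂ t₁ t₂ : ℝ} (ht₁ : t₁ ∈ Ioc a₁ b₁) (ht₂ : t₂ ∈ Ico a₂ b₂)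
    (hγ₁ : g.IsFutureCausalCurveOn τ γ₁ (Icc a₁ b₁)) (hγ₂ : g.IsFutureCausalCurveOn τ γ₂ (Icc a₂ b₂))
    (hmeet : γ₁ t₁ = γ₂ t₂) (h₁ : γ₁ a₁ ∈ S) (h₂ : γ₂ b₂ ∈ S) :
    ∃ c : ℝ, 0 < c ∧ (velocity I γ₂ t₂ : E) = c • (velocity I γ₁ t₁ : E) :=
  hS.exists_pos_smul_velocity_eq hn ht₁.1 ht₂.2 (hγ₁.mono (Icc_subset_Icc le_rfl ht₁.2))
    (hγ₂.mono (Icc_subset_Icc ht₂.1 le_rfl)) hmeet h₁ h₂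

end LorentzianMetric

end Achronal

/-! ### Null geodesic rays and the rigidity of generators -/

namespace Spacetime

variable {d : ℕ} {𝓢 : Spacetime.{u} d} [𝓢.metric.HasLeviCivita]

/-- The Levi-Civita connection of a spacetime metric is `C¹` (indeed smooth): instance form of
`PseudoRiemannianMetric.isLocallyContMDiff_leviCivita_holds`, needed by the uniqueness theorems for
geodesics. [folklore] -/
theorem contMDiffCovariantDerivative_leviCivita_one :
    CovariantDerivative.ContMDiffCovariantDerivative 𝓢.metric.leviCivita 1 :=
  ⟨𝓢.metric.isLocallyContMDiff_leviCivita_holds 1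
    (by rw [show ((1 : ℕ∞) : ℕ∞ω) + 1 = 2 by norm_num]; exact WithTop.coe_le_coe.2 le_top)
    univ isOpen_univ⟩

/-- **A future null geodesic ray is a future causal curve** on every parameter interval
`[s, t] ⊆ [a, ∞)`: it is differentiable there (`IsGeodesicOn.mdifferentiableAt_holds`) with
future-directed (null, hence causal) velocity. Chruściel–Delay–Galloway–Howard 2001, §2
(generators are future directed null geodesics). [cite: ChruscielEtAl2001, §2] -/
theorem isFutureCausalCurveOn_of_nullRay {γ : ℝ → 𝓢.carrier} {a s t : ℝ}
    (hgeo : IsGeodesicOn 𝓢.metric.leviCivita γ (Ici a))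
    (hfut : ∀ t ∈ Ici a, 𝓢.timeOrientation.IsFutureDirected (velocity (𝓡 d) γ t)) (hs : a ≤ s) :
    𝓢.metric.IsFutureCausalCurveOn 𝓢.timeOrientation γ (Icc s t) := fun r hr ↦
  ⟨IsGeodesicOn.mdifferentiableAt_holds hgeo (mem_Ici.mpr (hs.trans hr.1)),
    hfut r (mem_Ici.mpr (hs.trans hr.1))⟩

/-- **Rigidity of the generators of an achronal set** (Chruściel–Delay–Galloway–Howard 2001, §2;
Beem–Królak 1998). Let `𝓗` be achronal and let `γ : [a, ∞) → 𝓗`, `γ' : [a', ∞) → 𝓗` be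
future-directed null geodesic rays contained in `𝓗`. If `γ'` passes through (or starts at) a point
`γ' t' = γ t` of `γ` which is *not* the initial point of `γ` (`a < t`), then `γ'` is the
continuation of `γ` from that point on: `γ' s = γ (t + c (s - t'))` for all `s ≥ t'`, for some
`c > 0`. Proof: the velocities at the common point are positively proportional, since the curve
`γ|[a, t]` followed by `γ'|[t', t' + 1]` joins two points of the achronal set `𝓗` and so cannot
have a corner there (`IsAchronal.exists_pos_smul_velocity_eq`, O'Neill's Prop. 10.46); and a
geodesic ray is determined by its initial position and velocity
(`IsGeodesicOn.eqOn_Ici_comp_affine_of_velocity_eq_smul`). In particular through a point of a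
future horizon lying in the interior of one of its generators there passes exactly one generator
(loc. cit.: "`𝓗` is differentiable precisely at those points `p` which belong to exactly one
generator"). [cite: ChruscielEtAl2001, §2] -/
theorem exists_eqOn_ray_of_achronal {𝓗 : Set 𝓢.carrier}
    (h𝓗 : 𝓢.metric.IsAchronal 𝓢.timeOrientation 𝓗) {γ γ' : ℝ → 𝓢.carrier} {a a' t t' : ℝ}
    (hγ : IsGeodesicOn 𝓢.metric.leviCivita γ (Ici a))
    (hγfut : ∀ s ∈ Ici a, 𝓢.timeOrientation.IsFutureDirected (velocity (𝓡 d) γ s))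
    (hγ𝓗 : MapsTo γ (Ici a) 𝓗)
    (hγ' : IsGeodesicOn 𝓢.metric.leviCivita γ' (Ici a'))
    (hγ'fut : ∀ s ∈ Ici a', 𝓢.timeOrientation.IsFutureDirected (velocity (𝓡 d) γ' s))
    (hγ'𝓗 : MapsTo γ' (Ici a') 𝓗)
    (ht : a < t) (ht' : a' ≤ t') (hmeet : γ t = γ' t') :
    ∃ c : ℝ, 0 < c ∧ EqOn γ' (fun s ↦ γ (t + c * (s - t'))) (Ici t') := by
  haveI : CovariantDerivative.ContMDiffCovariantDerivative 𝓢.metric.leviCivita 1 :=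
    contMDiffCovariantDerivative_leviCivita_one
  -- no corner at the common point
  have h₁ : 𝓢.metric.IsFutureCausalCurveOn 𝓢.timeOrientation γ (Icc a t) :=
    isFutureCausalCurveOn_of_nullRay hγ hγfut le_rfl
  have h₂ : 𝓢.metric.IsFutureCausalCurveOn 𝓢.timeOrientation γ' (Icc t' (t' + 1)) :=
    isFutureCausalCurveOn_of_nullRay hγ' hγ'fut ht'
  have hn : (1 : ℕ∞ω) ≤ ∞ := by exact_mod_cast le_top
  have ht'1 : t' < t' + 1 := by linarith
  have ha : γ a ∈ 𝓗 := hγ𝓗 (mem_Ici.mpr le_rfl)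
  have hb : γ' (t' + 1) ∈ 𝓗 := hγ'𝓗 (mem_Ici.mpr (by linarith))
  obtain ⟨c, hc, hv⟩ :=
    LorentzianMetric.IsAchronal.exists_pos_smul_velocity_eq hn h𝓗 ht ht'1 h₁ h₂ hmeet ha hb
  -- one-sided uniqueness of geodesics
  refine ⟨c, hc, ?_⟩
  have hγ'' : IsGeodesicOn 𝓢.metric.leviCivita γ' (Ici t') := hγ'.mono (Ici_subset_Ici.mpr ht')
  exact IsGeodesicOn.eqOn_Ici_comp_affine_of_velocity_eq_smul hγ hγ'' ht.le hc.le hmeet.symm hv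

/-- **Two generators through a common interior point coincide to the future.** In an achronal set
`𝓗`, if two future null geodesic rays `γ, γ'` of `𝓗` meet at `γ t = γ' t'` with `t`, `t'` both
later than the respective initial parameters, then each is a reparametrisation of the other from
the meeting point on; here: the points of `γ'` after `t'` are points of `γ` after `t`.
Chruściel–Delay–Galloway–Howard 2001, §2. [cite: ChruscielEtAl2001, §2] -/
theorem image_ray_subset_of_achronal {𝓗 : Set 𝓢.carrier}
    (h𝓗 : 𝓢.metric.IsAchronal 𝓢.timeOrientation 𝓗) {γ γ' : ℝ → 𝓢.carrier} {a a' t t' : ℝ}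
    (hγ : IsGeodesicOn 𝓢.metric.leviCivita γ (Ici a))
    (hγfut : ∀ s ∈ Ici a, 𝓢.timeOrientation.IsFutureDirected (velocity (𝓡 d) γ s))
    (hγ𝓗 : MapsTo γ (Ici a) 𝓗)
    (hγ' : IsGeodesicOn 𝓢.metric.leviCivita γ' (Ici a'))
    (hγ'fut : ∀ s ∈ Ici a', 𝓢.timeOrientation.IsFutureDirected (velocity (𝓡 d) γ' s))
    (hγ'𝓗 : MapsTo γ' (Ici a') 𝓗)
    (ht : a < t) (ht' : a' ≤ t') (hmeet : γ t = γ' t') :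
    γ' '' Ici t' ⊆ γ '' Ici t := by
  obtain ⟨c, hc, heq⟩ := exists_eqOn_ray_of_achronal h𝓗 hγ hγfut hγ𝓗 hγ' hγ'fut hγ'𝓗 ht ht' hmeet
  rintro _ ⟨s, hs, rfl⟩
  refine ⟨t + c * (s - t'), ?_, (heq hs).symm⟩
  have : 0 ≤ c * (s - t') := mul_nonneg hc.le (by linarith [mem_Ici.mp hs])
  exact mem_Ici.mpr (by linarith)

/-- **Every generator segment of an achronal set ruled by complete null geodesics lies on a
complete generator** (the printed hypothesis "the generators of `𝓗` are future complete" of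
Chruściel–Delay–Galloway–Howard 2001, Thm. 1.1 (b), recovered from the pointwise ruling
`IsRuledByCompleteNullGeodesics` under achronality). Let `𝓗` be achronal and ruled by
future-complete null geodesics, and let `η` be a future-directed (null) geodesic on `[s₀, s₁]` with
values in `𝓗`. Then for every `s' ∈ (s₀, s₁]` the piece `η|[s', s₁]` is an initial piece of one of
the complete rays of the ruling: `η s = γ (t₀ + c (s - s'))` on `[s', s₁]` with `γ : [a, ∞) → 𝓗` a
future-complete null geodesic ray of `𝓗`, `a ≤ t₀`, `c > 0`. (No corner at `η s'` between
`η|[s₀, s']` and the ray through `η s'`, then forward uniqueness on `[s', s₁]`.)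
[cite: ChruscielEtAl2001, §2 and Thm. 1.1 (b)] -/
theorem IsRuledByCompleteNullGeodesics.exists_ray_through_segment {𝓗 : Set 𝓢.carrier}
    (hrule : 𝓢.IsRuledByCompleteNullGeodesics 𝓗)
    (h𝓗 : 𝓢.metric.IsAchronal 𝓢.timeOrientation 𝓗) {η : ℝ → 𝓢.carrier} {s₀ s' s₁ : ℝ}
    (hs₀ : s₀ < s') (hs₁ : s' ≤ s₁) (hη : IsGeodesicOn 𝓢.metric.leviCivita η (Icc s₀ s₁))
    (hηfut : ∀ s ∈ Icc s₀ s₁, 𝓢.timeOrientation.IsFutureDirected (velocity (𝓡 d) η s))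
    (hη𝓗 : MapsTo η (Icc s₀ s₁) 𝓗) :
    ∃ (γ : ℝ → 𝓢.carrier) (a t₀ c : ℝ), a ≤ t₀ ∧ 0 < c ∧
      IsGeodesicOn 𝓢.metric.leviCivita γ (Ici a) ∧
      (∀ t ∈ Ici a, 𝓢.metric.IsNull (velocity (𝓡 d) γ t) ∧
        𝓢.timeOrientation.IsFutureDirected (velocity (𝓡 d) γ t)) ∧
      MapsTo γ (Ici a) 𝓗 ∧ EqOn η (fun s ↦ γ (t₀ + c * (s - s'))) (Icc s' s₁) := by
  haveI : CovariantDerivative.ContMDiffCovariantDerivative 𝓢.metric.leviCivita 1 :=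
    contMDiffCovariantDerivative_leviCivita_one
  -- the complete ray of the ruling through `q = η s'`
  have hq : η s' ∈ 𝓗 := hη𝓗 ⟨hs₀.le, hs₁⟩
  obtain ⟨γ, a, t₀, hat₀, hγq, hγgeo, hγnf, hγ𝓗⟩ := hrule (η s') hq
  -- no corner at `q` between `η|[s₀, s']` and `γ|[t₀, t₀ + 1]`
  have h₁ : 𝓢.metric.IsFutureCausalCurveOn 𝓢.timeOrientation η (Icc s₀ s') := fun r hr ↦
    ⟨IsGeodesicOn.mdifferentiableAt_holds hη ⟨hr.1, hr.2.trans hs₁⟩, hηfut r ⟨hr.1, hr.2.trans hs₁⟩⟩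
  have h₂ : 𝓢.metric.IsFutureCausalCurveOn 𝓢.timeOrientation γ (Icc t₀ (t₀ + 1)) :=
    isFutureCausalCurveOn_of_nullRay hγgeo (fun t ht ↦ (hγnf t ht).2) hat₀
  have hn : (1 : ℕ∞ω) ≤ ∞ := by exact_mod_cast le_top
  have ht₀1 : t₀ < t₀ + 1 := by linarith
  have ha : η s₀ ∈ 𝓗 := hη𝓗 ⟨le_rfl, hs₀.le.trans hs₁⟩
  have hb : γ (t₀ + 1) ∈ 𝓗 := hγ𝓗 (mem_Ici.mpr (by linarith))
  obtain ⟨c, hc, hv⟩ :=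
    LorentzianMetric.IsAchronal.exists_pos_smul_velocity_eq hn h𝓗 hs₀ ht₀1 h₁ h₂ hγq.symm ha hb
  -- the reparametrised ray `ζ u = γ (t₀ + (u - s') / c)` has the data of `η` at `s'`
  set ζ : ℝ → 𝓢.carrier := fun u ↦ γ (c⁻¹ * u + (t₀ - c⁻¹ * s')) with hζ
  have hpre : Icc s' s₁ ⊆ (fun u ↦ c⁻¹ * u + (t₀ - c⁻¹ * s')) ⁻¹' Ici a := by
    intro u hu
    have : 0 ≤ c⁻¹ * (u - s') := mul_nonneg (inv_nonneg.mpr hc.le) (by linarith [hu.1])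
    show a ≤ c⁻¹ * u + (t₀ - c⁻¹ * s')
    nlinarith
  have hζgeo : IsGeodesicOn 𝓢.metric.leviCivita ζ (Icc s' s₁) :=
    (IsGeodesicOn.comp_affine_holds hγgeo c⁻¹ _).mono hpre
  have harg : c⁻¹ * s' + (t₀ - c⁻¹ * s') = t₀ := by ring
  have hζ0 : η s' = ζ s' := by simp only [hζ, harg]; exact hγq.symm
  have hζv : velocity (𝓡 d) η s' = velocity (𝓡 d) ζ s' := by
    have h1 : (velocity (𝓡 d) ζ s' : EuclideanSpace ℝ (Fin d)) =
        c⁻¹ • (velocity (𝓡 d) γ (c⁻¹ * s' + (t₀ - c⁻¹ * s')) : EuclideanSpace ℝ (Fin d)) :=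
      velocity_comp_affine γ c⁻¹ (t₀ - c⁻¹ * s') s'
    have h2 : c⁻¹ • (velocity (𝓡 d) γ (c⁻¹ * s' + (t₀ - c⁻¹ * s')) : EuclideanSpace ℝ (Fin d)) =
        c⁻¹ • (velocity (𝓡 d) γ t₀ : EuclideanSpace ℝ (Fin d)) := by rw [harg]
    have key : ∀ v w : EuclideanSpace ℝ (Fin d), w = c • v → c⁻¹ • w = v := fun v w h ↦ by
      rw [h, smul_smul, inv_mul_cancel₀ hc.ne', one_smul]
    have h3 : (velocity (𝓡 d) ζ s' : EuclideanSpace ℝ (Fin d)) =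
        (velocity (𝓡 d) η s' : EuclideanSpace ℝ (Fin d)) := by
      rw [h1, h2]
      exact key (velocity (𝓡 d) η s') (velocity (𝓡 d) γ t₀) hv
    exact h3.symm
  have heq : EqOn η ζ (Icc s' s₁) :=
    IsGeodesicOn.eqOn_Icc_of_velocity_eq (hη.mono (Icc_subset_Icc hs₀.le le_rfl)) hζgeo hζ0 hζv
  refine ⟨γ, a, t₀, c⁻¹, hat₀, inv_pos.mpr hc, hγgeo, hγnf, hγ𝓗, fun s hs ↦ ?_⟩
  rw [heq hs]
  show γ (c⁻¹ * s + (t₀ - c⁻¹ * s')) = γ (t₀ + c⁻¹ * (s - s'))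
  congr 1; ring

end Spacetime

/-! ### Sections of a horizon by slicing hypersurfaces -/

section Sections

variable {d : ℕ} {𝓢 : Spacetime.{u} d} {m : ℕ}
  {L : Type u} [TopologicalSpace L] [ChartedSpace (EuclideanSpace ℝ (Fin m)) L]

/-- The section `σ⁻¹(𝓗)` of a closed set `𝓗 ⊆ M` (a horizon) by a slicing hypersurface
`σ : L → M` which is a smooth embedding is closed in `L`. In the setting of
`ChruscielEtAl2001_areaTheorem` this is (the relevant case of) Chruściel–Delay–Galloway–Howard 2001,
Prop. 3.3 ("`𝒮 ∩ 𝓗` is a Borel set"). [cite: ChruscielEtAl2001, Prop. 3.3] -/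
theorem isClosed_preimage_horizon {𝓗 : Set 𝓢.carrier} (h𝓗 : IsClosed 𝓗) {σ : L → 𝓢.carrier}
    (hσ : Manifold.IsSmoothEmbedding (𝓡 m) (𝓡 d) ∞ σ) : IsClosed (σ ⁻¹' 𝓗) :=
  h𝓗.preimage hσ.isEmbedding.continuous

/-- The section `σ⁻¹(𝓗)` of a closed `𝓗` by a smooth embedding `σ : L → M` is a Borel set of the
leaf, in particular measurable for the Hausdorff area of `Volume.lean`. Chruściel–Delay–Galloway–
Howard 2001, Prop. 3.3. [cite: ChruscielEtAl2001, Prop. 3.3] -/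
theorem measurableSet_preimage_horizon [MeasurableSpace L] [BorelSpace L] {𝓗 : Set 𝓢.carrier}
    (h𝓗 : IsClosed 𝓗) {σ : L → 𝓢.carrier} (hσ : Manifold.IsSmoothEmbedding (𝓡 m) (𝓡 d) ∞ σ) :
    MeasurableSet (σ ⁻¹' 𝓗) :=
  (isClosed_preimage_horizon h𝓗 hσ).measurableSet

/-- A compact section is of course compact as a subset of the leaf when `𝓗` is closed and the
image of the leaf meets `𝓗` in a compact set: `σ⁻¹(𝓗) = σ⁻¹(σ(L) ∩ 𝓗)` and `σ` is a closed
embedding onto its image. Recorded in the form: if `K ⊆ L` is compact then so is its image section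
`σ(K) ∩ 𝓗`. [folklore] -/
theorem isCompact_image_inter_horizon {𝓗 : Set 𝓢.carrier} (h𝓗 : IsClosed 𝓗)
    {σ : L → 𝓢.carrier} (hσ : Manifold.IsSmoothEmbedding (𝓡 m) (𝓡 d) ∞ σ) {K : Set L}
    (hK : IsCompact K) : IsCompact (σ '' K ∩ 𝓗) :=
  (hK.image hσ.isEmbedding.continuous).inter_right h𝓗

end Sections

section Degenerate

variable {m : ℕ} {L₁ : Type*} [TopologicalSpace L₁] [ChartedSpace (EuclideanSpace ℝ (Fin m)) L₁]
  [IsManifold (𝓡 m) 1 L₁] [T3Space L₁] [MeasurableSpace L₁] [BorelSpace L₁]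
  {L₂ : Type*} [TopologicalSpace L₂] [ChartedSpace (EuclideanSpace ℝ (Fin m)) L₂]
  [IsManifold (𝓡 m) 1 L₂] [T3Space L₂] [MeasurableSpace L₂] [BorelSpace L₂]

/-- **The area inequality in the degenerate case of an empty earlier section**: if `σ₁(L₁)` does
not meet `𝓗` then `Area(S₁) = 0 ≤ Area(S₂)`, whatever `S₂` is (the areas of `Volume.lean` are
measures). This disposes of the trivial case of Chruściel–Delay–Galloway–Howard 2001, Thm. 6.1.
[folklore] -/
theorem area_preimage_le_of_eq_empty {M : Type*}
    (h₁ : ContMDiffRiemannianMetric (𝓡 m) ∞ (EuclideanSpace ℝ (Fin m)) (TangentSpace (𝓡 m) : L₁ → Type _))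
    (h₂ : ContMDiffRiemannianMetric (𝓡 m) ∞ (EuclideanSpace ℝ (Fin m)) (TangentSpace (𝓡 m) : L₂ → Type _))
    {σ₁ : L₁ → M} {σ₂ : L₂ → M} {𝓗 : Set M} (h : σ₁ ⁻¹' 𝓗 = ∅) :
    area h₁ (σ₁ ⁻¹' 𝓗) ≤ area h₂ (σ₂ ⁻¹' 𝓗) := by
  rw [h, area_eq, measure_empty]
  exact zero_le

end Degenerate

end Literature.Geometry.Lorentzian

end
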